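import Summits.MatrixMultiplication.MatrixMultiplication.Theorems.GradedDesignFamily.Negative.SubfieldCellTwistedCentralizer

/-!
# Subfield cell: (F2) reduced to a slice count — `#{h | b ι(h) b' ∈ S₀ g S₀} ≤ 2q · #(slice)`

Unit `b2b-lgcu-subfield` (gen 20), supporting `stmt-MatrixMultiplication-7610`; BGT-free plan
(SUBFIELD.md §25, `BGTFreePlan.F2`).  Notation: `ι : k →+* K`, `|K| = |k|² = q²`, `σ = Frob_q`,
`S₀ = SL₂(ι k)`, `N = N(S₀)`, twisted element `z_y = y σ(y)⁻¹`.

* `trace_twist_eq`: if `b ι(h) b' = s g s'` with `s, s' ∈ S₀` then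
  `tr(σ(b)⁻¹ b · ι(h) z_{b'} ι(h)⁻¹) = tr z_g` — membership in the double coset `S₀ g S₀` forces ONE
  trace condition on the `S₀`-conjugate `X_h = ι(h) z_{b'} ι(h)⁻¹` of `z_{b'}`;
* `card_commutant_le`: a non-scalar `2 × 2` matrix over `K` commutes with at most `2q` elements of
  `ι(SL₂ k)`; hence (`card_conjPreimage_le`) `#{h | X_h ∈ 𝒳} ≤ 2q · |𝒳|` for any finite `𝒳`;
* `traceFibre_card_le_of_sliceCount`: **(F2) follows from the SLICE COUNT**
  (D) `#{X ∈ SL₂(K) | σ(X) = X⁻¹, tr X = t, tr(m X) = c} ≤ 4q` for `m ≠ ±1`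
  — an affine-plane section of a rank-3 quadric over `k` (true bound `2q`; `4q` by elementary
  elimination, SUBFIELD.md §25), giving (F2') `#{h | b ι(h) b' ∈ S₀ g S₀} ≤ 8q²`.

HONEST FRAMING: finite-group bookkeeping toward an unconditional `¬ stub_subfieldCell`;
NOT summit progress.  Sorry-free. [folklore]
-/

set_option linter.dupNamespace false

namespace Summit.MatrixMultiplication.MatrixMultiplication.Theorems.GradedDesignFamily.Negative

open scoped MatrixGroups
open Matrix.SpecialLinearGroup

variable {k K : Type} [Field k] [Fintype k] [DecidableEq k] [Field K] [Fintype K] [DecidableEq K]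

/-! ## Traces -/

omit [Fintype K] [DecidableEq K] in
/-- `tr(AB) = tr(BA)` in `SL₂`. [folklore] -/
theorem trace_coe_mul_comm (A B : SL(2, K)) :
    Matrix.trace ((A * B : SL(2, K)) : Matrix (Fin 2) (Fin 2) K) =
      Matrix.trace ((B * A : SL(2, K)) : Matrix (Fin 2) (Fin 2) K) := by
  rw [coe_mul, coe_mul, Matrix.trace_mul_comm]

omit [Fintype K] [DecidableEq K] in
/-- The trace is a class function on `SL₂`. [folklore] -/
theorem trace_coe_conj (s Z : SL(2, K)) :
    Matrix.trace ((s * Z * s⁻¹ : SL(2, K)) : Matrix (Fin 2) (Fin 2) K) =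
      Matrix.trace ((Z : SL(2, K)) : Matrix (Fin 2) (Fin 2) K) := by
  rw [trace_coe_mul_comm, ← mul_assoc, inv_mul_cancel, one_mul]

omit [DecidableEq k] in
/-- **Trace condition from double-coset membership.**  If `b ι(h) b' = s g s'` with `s, s' ∈ S₀`
then `tr(σ(b)⁻¹ b · X_h) = tr z_g`, where `X_h = ι(h) z_{b'} ι(h)⁻¹`, `z_y = y σ(y)⁻¹`. [folklore] -/
theorem trace_twist_eq (ι : k →+* K) (σ : K →+* K) (hσ : ∀ x, σ x = x ^ Fintype.card k)
    (b b' g s s' : SL(2, K)) (hs : s ∈ (map (n := Fin 2) ι).range)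
    (hs' : s' ∈ (map (n := Fin 2) ι).range) (h : SL(2, k))
    (e : b * map ι h * b' = s * g * s') :
    Matrix.trace ((((map σ b)⁻¹ * b) * (map ι h * (b' * (map σ b')⁻¹) * (map ι h)⁻¹) : SL(2, K)) :
        Matrix (Fin 2) (Fin 2) K) =
      Matrix.trace ((g * (map σ g)⁻¹ : SL(2, K)) : Matrix (Fin 2) (Fin 2) K) := by
  have hsf : map σ s = s := (mem_subfieldSL_iff ι σ hσ s).mp hs
  have hsf' : map σ s' = s' := (mem_subfieldSL_iff ι σ hσ s').mp hs'
  have hh : map σ (map ι h) = map ι h := frobSL_map ι σ hσ h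
  have A : b * (map ι h * (b' * (map σ b')⁻¹) * (map ι h)⁻¹) * (map σ b)⁻¹ =
      (b * map ι h * b') * (map σ (b * map ι h * b'))⁻¹ := by
    rw [map_mul, map_mul, hh]; group
  have B : (b * map ι h * b') * (map σ (b * map ι h * b'))⁻¹ = s * (g * (map σ g)⁻¹) * s⁻¹ := by
    rw [e, map_mul, map_mul, hsf, hsf']; group
  calc Matrix.trace ((((map σ b)⁻¹ * b) * (map ι h * (b' * (map σ b')⁻¹) * (map ι h)⁻¹) :
          SL(2, K)) : Matrix (Fin 2) (Fin 2) K)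
      = Matrix.trace (((map σ b)⁻¹ * (b * (map ι h * (b' * (map σ b')⁻¹) * (map ι h)⁻¹)) :
          SL(2, K)) : Matrix (Fin 2) (Fin 2) K) := by rw [mul_assoc]
    _ = Matrix.trace (((b * (map ι h * (b' * (map σ b')⁻¹) * (map ι h)⁻¹)) * (map σ b)⁻¹ :
          SL(2, K)) : Matrix (Fin 2) (Fin 2) K) := trace_coe_mul_comm _ _
    _ = Matrix.trace ((s * (g * (map σ g)⁻¹) * s⁻¹ : SL(2, K)) : Matrix (Fin 2) (Fin 2) K) := by
          rw [A, B]
    _ = _ := trace_coe_conj _ _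

/-! ## The commutant count and conjugation preimages -/

omit [Fintype K] in
/-- A non-scalar `2 × 2` matrix `zM` over `K` commutes with at most `2q` elements of `ι(SL₂ k)`
(the commutant `{x•1 + y•h₀}` meets `det = 1` in at most two `x` per `y`). [folklore] -/
theorem card_commutant_le (ι : k →+* K) (zM : Matrix (Fin 2) (Fin 2) K)
    (hzns : ¬ (zM 0 1 = 0 ∧ zM 1 0 = 0 ∧ zM 0 0 = zM 1 1)) :
    (Finset.univ.filter fun h : SL(2, k) =>
        ι.mapMatrix (h : Matrix (Fin 2) (Fin 2) k) * zM =
          zM * ι.mapMatrix (h : Matrix (Fin 2) (Fin 2) k)).card ≤ 2 * Fintype.card k := by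
  set Cz : Finset (SL(2, k)) := Finset.univ.filter fun h =>
      ι.mapMatrix (h : Matrix (Fin 2) (Fin 2) k) * zM =
        zM * ι.mapMatrix (h : Matrix (Fin 2) (Fin 2) k)
    with hCz
  have hq2 : 2 ≤ Fintype.card k := Fintype.one_lt_card
  by_cases hex : ∃ h₀ ∈ Cz, ¬ (((h₀ : SL(2, k)) : Matrix (Fin 2) (Fin 2) k) 0 1 = 0 ∧
      ((h₀ : SL(2, k)) : Matrix (Fin 2) (Fin 2) k) 1 0 = 0 ∧
      ((h₀ : SL(2, k)) : Matrix (Fin 2) (Fin 2) k) 0 0 =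
      ((h₀ : SL(2, k)) : Matrix (Fin 2) (Fin 2) k) 1 1)
  · obtain ⟨h₀, hh₀, hns⟩ := hex
    set H₀ : Matrix (Fin 2) (Fin 2) k := (h₀ : Matrix (Fin 2) (Fin 2) k) with hH₀
    have hh₀' : ι.mapMatrix H₀ * zM = zM * ι.mapMatrix H₀ := by
      simp only [hCz, Finset.mem_filter, Finset.mem_univ, true_and] at hh₀; exact hh₀
    have hinjM : Function.Injective
        (ι.mapMatrix : Matrix (Fin 2) (Fin 2) k → Matrix (Fin 2) (Fin 2) K) := by
      intro a b hab
      ext i j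
      have := congrFun (congrFun hab i) j
      exact ι.injective (by simpa using this)
    have hcomm : ∀ h ∈ Cz,
        (h : Matrix (Fin 2) (Fin 2) k) * H₀ = H₀ * (h : Matrix (Fin 2) (Fin 2) k) := by
      intro h hh
      simp only [hCz, Finset.mem_filter, Finset.mem_univ, true_and] at hh
      have hc := commute_of_commute_nonscalar zM _ _ hzns hh hh₀'
      rw [← map_mul, ← map_mul] at hc
      exact hinjM hc
    have hdet0 : H₀.det = 1 := h₀.det_coe
    set T : Finset (k × k) := Finset.univ.filter fun xy : k × k =>
        (xy.1 • (1 : Matrix (Fin 2) (Fin 2) k) + xy.2 • H₀).det = 1 with hT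
    have hsub : Cz.image (fun h : SL(2, k) => (h : Matrix (Fin 2) (Fin 2) k)) ⊆
        T.image fun xy : k × k => xy.1 • (1 : Matrix (Fin 2) (Fin 2) k) + xy.2 • H₀ := by
      intro M hM
      obtain ⟨h, hh, rfl⟩ := Finset.mem_image.mp hM
      obtain ⟨x, y, hxy⟩ := exists_eq_smul_one_add_smul_of_commute H₀ _ hns (hcomm h hh)
      refine Finset.mem_image.mpr ⟨(x, y), ?_, hxy.symm⟩
      simp only [hT, Finset.mem_filter, Finset.mem_univ, true_and]
      rw [← hxy]
      exact h.det_coe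
    calc Cz.card = (Cz.image fun h : SL(2, k) =>
          (h : Matrix (Fin 2) (Fin 2) k)).card :=
          (Finset.card_image_of_injective _ (fun a b hab => Subtype.ext hab)).symm
      _ ≤ (T.image fun xy : k × k => xy.1 • (1 : Matrix (Fin 2) (Fin 2) k) + xy.2 • H₀).card :=
          Finset.card_le_card hsub
      _ ≤ T.card := Finset.card_image_le
      _ ≤ 2 * Fintype.card k := card_filter_det_smul_le H₀ hdet0
  · push Not at hex
    have hsub : Cz ⊆ {1, -1} := by
      intro h hh
      have hs := hex h hh
      rcases eq_one_or_eq_neg_one_of_scalar (h : Matrix (Fin 2) (Fin 2) k) hs h.det_coe with e | e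
      · have : h = 1 := by ext i j; rw [e]; simp
        simp [this]
      · have : h = -1 := by ext i j; rw [e]; simp
        simp [this]
    calc Cz.card ≤ ({1, -1} : Finset (SL(2, k))).card := Finset.card_le_card hsub
      _ ≤ 2 := Finset.card_le_two
      _ ≤ 2 * Fintype.card k := by omega

omit [Fintype K] in
/-- **Conjugation preimages.**  For non-scalar `z' ∈ SL₂(K)` and a finite set `𝒳`,
`#{h ∈ SL₂(k) | ι(h) z' ι(h)⁻¹ ∈ 𝒳} ≤ 2q · |𝒳|` (fibres are cosets of the commutant). [folklore] -/
theorem card_conjPreimage_le (ι : k →+* K) (z' : SL(2, K))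
    (hzns : ¬ ((z' : Matrix (Fin 2) (Fin 2) K) 0 1 = 0 ∧ (z' : Matrix (Fin 2) (Fin 2) K) 1 0 = 0 ∧
      (z' : Matrix (Fin 2) (Fin 2) K) 0 0 = (z' : Matrix (Fin 2) (Fin 2) K) 1 1))
    (𝒳 : Finset SL(2, K)) :
    (Finset.univ.filter fun h : SL(2, k) => map ι h * z' * (map ι h)⁻¹ ∈ 𝒳).card ≤
      2 * Fintype.card k * 𝒳.card := by
  set F := Finset.univ.filter fun h : SL(2, k) => map ι h * z' * (map ι h)⁻¹ ∈ 𝒳 with hF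
  refine Finset.card_le_mul_card_image_of_maps_to
    (f := fun h : SL(2, k) => map ι h * z' * (map ι h)⁻¹) (t := 𝒳)
    (fun h hh => (Finset.mem_filter.mp hh).2) _ ?_
  intro X _
  rcases (F.filter fun h => map ι h * z' * (map ι h)⁻¹ = X).eq_empty_or_nonempty with h0 | ⟨h₀, hh₀⟩
  · rw [h0]; simp
  have e₀ : map ι h₀ * z' * (map ι h₀)⁻¹ = X := (Finset.mem_filter.mp hh₀).2
  have hinj : Set.InjOn (fun h : SL(2, k) => h₀⁻¹ * h)
      ↑(F.filter fun h => map ι h * z' * (map ι h)⁻¹ = X) := fun x _ y _ hxy => mul_left_cancel hxy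
  have hcoe : ∀ x : SL(2, k), ((map ι x : SL(2, K)) : Matrix (Fin 2) (Fin 2) K) =
      ι.mapMatrix (x : Matrix (Fin 2) (Fin 2) k) := by
    intro x; simp [Matrix.SpecialLinearGroup.map]
  calc (F.filter fun h => map ι h * z' * (map ι h)⁻¹ = X).card
      = ((F.filter fun h => map ι h * z' * (map ι h)⁻¹ = X).image fun h => h₀⁻¹ * h).card :=
        (Finset.card_image_of_injOn hinj).symm
    _ ≤ (Finset.univ.filter fun h : SL(2, k) =>
          ι.mapMatrix (h : Matrix (Fin 2) (Fin 2) k) * (z' : Matrix (Fin 2) (Fin 2) K) =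
            (z' : Matrix (Fin 2) (Fin 2) K) * ι.mapMatrix (h : Matrix (Fin 2) (Fin 2) k)).card := by
        apply Finset.card_le_card
        intro x hx
        obtain ⟨h, hh, rfl⟩ := Finset.mem_image.mp hx
        have e : map ι h * z' * (map ι h)⁻¹ = X := (Finset.mem_filter.mp hh).2
        simp only [Finset.mem_filter, Finset.mem_univ, true_and]
        have hSL : map ι (h₀⁻¹ * h) * z' = z' * map ι (h₀⁻¹ * h) := by
          have e' : map ι h * z' * (map ι h)⁻¹ = map ι h₀ * z' * (map ι h₀)⁻¹ := e.trans e₀.symm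
          rw [map_mul, map_inv]
          calc (map ι h₀)⁻¹ * map ι h * z'
              = (map ι h₀)⁻¹ * (map ι h * z' * (map ι h)⁻¹) * map ι h := by group
            _ = (map ι h₀)⁻¹ * (map ι h₀ * z' * (map ι h₀)⁻¹) * map ι h := by rw [e']
            _ = z' * ((map ι h₀)⁻¹ * map ι h) := by group
        have := congrArg (fun g : SL(2, K) => (g : Matrix (Fin 2) (Fin 2) K)) hSL
        simpa only [coe_mul, hcoe] using this
    _ ≤ 2 * Fintype.card k := card_commutant_le ι _ hzns

/-! ## (F2) from the slice count (D) -/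

/-- **(F2') ⟸ (D).**  If every slice `{X ∈ SL₂(K) | σ X = X⁻¹, tr X = t, tr(mX) = c}` (`m ≠ ±1`)
has at most `4q` elements, then `#{h ∈ SL₂(k) | b ι(h) b' ∈ S₀ g S₀} ≤ 8q²` for
`b, b', g ∉ N(S₀)` (the shape of `BGTFreePlan.F2` up to the constant).  NOT summit progress.
[folklore] -/
theorem traceFibre_card_le_of_sliceCount
    (hD : ∀ (k K : Type) [Field k] [Fintype k] [DecidableEq k] [Field K] [Fintype K] [DecidableEq K]
      (_ι : k →+* K), Fintype.card K = Fintype.card k ^ 2 →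
      ∀ σ : K →+* K, (∀ x, σ x = x ^ Fintype.card k) →
      ∀ m : Matrix.SpecialLinearGroup (Fin 2) K, m ≠ 1 → m ≠ -1 → ∀ t c : K,
        Nat.card {X : Matrix.SpecialLinearGroup (Fin 2) K //
          Matrix.SpecialLinearGroup.map σ X = X⁻¹ ∧
          Matrix.trace (X : Matrix (Fin 2) (Fin 2) K) = t ∧
          Matrix.trace ((m * X : Matrix.SpecialLinearGroup (Fin 2) K) :
            Matrix (Fin 2) (Fin 2) K) = c} ≤ 4 * Fintype.card k)
    (k K : Type) [Field k] [Fintype k] [DecidableEq k] [Field K] [Fintype K] [DecidableEq K]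
    (ι : k →+* K) (hK : Fintype.card K = Fintype.card k ^ 2)
    (b b' g : Matrix.SpecialLinearGroup (Fin 2) K)
    (hb : b ∉ Subgroup.normalizer (((Matrix.SpecialLinearGroup.map ι :
        Matrix.SpecialLinearGroup (Fin 2) k →* Matrix.SpecialLinearGroup (Fin 2) K).range :
        Subgroup (Matrix.SpecialLinearGroup (Fin 2) K)) :
        Set (Matrix.SpecialLinearGroup (Fin 2) K)))
    (hb' : b' ∉ Subgroup.normalizer (((Matrix.SpecialLinearGroup.map ι :
        Matrix.SpecialLinearGroup (Fin 2) k →* Matrix.SpecialLinearGroup (Fin 2) K).range :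
        Subgroup (Matrix.SpecialLinearGroup (Fin 2) K)) :
        Set (Matrix.SpecialLinearGroup (Fin 2) K)))
    (_hg : g ∉ Subgroup.normalizer (((Matrix.SpecialLinearGroup.map ι :
        Matrix.SpecialLinearGroup (Fin 2) k →* Matrix.SpecialLinearGroup (Fin 2) K).range :
        Subgroup (Matrix.SpecialLinearGroup (Fin 2) K)) :
        Set (Matrix.SpecialLinearGroup (Fin 2) K))) :
    Nat.card {h : Matrix.SpecialLinearGroup (Fin 2) k //
      ∃ s ∈ (Matrix.SpecialLinearGroup.map ι :
          Matrix.SpecialLinearGroup (Fin 2) k →* Matrix.SpecialLinearGroup (Fin 2) K).range,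
      ∃ s' ∈ (Matrix.SpecialLinearGroup.map ι :
          Matrix.SpecialLinearGroup (Fin 2) k →* Matrix.SpecialLinearGroup (Fin 2) K).range,
        b * Matrix.SpecialLinearGroup.map ι h * b' = s * g * s'} ≤
      8 * Fintype.card k ^ 2 := by
  classical
  obtain ⟨σ, hσ⟩ := exists_frobenius ι
  set z' : SL(2, K) := b' * (map σ b')⁻¹ with hz'
  set m : SL(2, K) := (map σ b)⁻¹ * b with hm
  set c₀ : K := Matrix.trace ((g * (map σ g)⁻¹ : SL(2, K)) : Matrix (Fin 2) (Fin 2) K) with hc₀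
  set t : K := Matrix.trace ((z' : SL(2, K)) : Matrix (Fin 2) (Fin 2) K) with ht
  set 𝒳 : Finset SL(2, K) := Finset.univ.filter fun X =>
      map σ X = X⁻¹ ∧ Matrix.trace (X : Matrix (Fin 2) (Fin 2) K) = t ∧
        Matrix.trace ((m * X : SL(2, K)) : Matrix (Fin 2) (Fin 2) K) = c₀ with h𝒳
  have hzns := twisted_nonscalar ι σ hσ hb'
  rw [← hz'] at hzns
  -- `m ≠ ±1` because `b ∉ N`
  have hm1 : m ≠ 1 := by
    intro e
    apply hb
    apply mem_normalizer_of_frobSL ι σ hσ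
    left
    calc map σ b = map σ b * m := by rw [e, mul_one]
      _ = b := by rw [hm]; group
  have hm2 : m ≠ -1 := by
    intro e
    apply hb
    apply mem_normalizer_of_frobSL ι σ hσ
    right
    calc map σ b = -(map σ b * m) := by rw [e, mul_neg, mul_one, neg_neg]
      _ = -b := by rw [hm]; congr 1; group
  have h𝒳card : 𝒳.card ≤ 4 * Fintype.card k := by
    have := hD k K ι hK σ hσ m hm1 hm2 t c₀
    rwa [Nat.card_eq_fintype_card, Fintype.card_subtype] at this
  -- the (F2)-set is contained in the conjugation preimage of `𝒳`
  have hsub : ∀ h : SL(2, k), (∃ s ∈ (map (n := Fin 2) ι).range, ∃ s' ∈ (map (n := Fin 2) ι).range,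
      b * map ι h * b' = s * g * s') → map ι h * z' * (map ι h)⁻¹ ∈ 𝒳 := by
    rintro h ⟨s, hs, s', hs', e⟩
    simp only [h𝒳, Finset.mem_filter, Finset.mem_univ, true_and]
    refine ⟨?_, ?_, ?_⟩
    · rw [map_mul, map_mul, map_inv, frobSL_map ι σ hσ, hz', map_mul, map_inv,
        frobSL_frobSL σ hσ hK]
      group
    · rw [ht]
      exact trace_coe_conj _ _
    · rw [hc₀, ← trace_twist_eq ι σ hσ b b' g s s' hs hs' h e, hm, hz']
  calc Nat.card {h : SL(2, k) // ∃ s ∈ (map (n := Fin 2) ι).range,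
        ∃ s' ∈ (map (n := Fin 2) ι).range, b * map ι h * b' = s * g * s'}
      ≤ (Finset.univ.filter fun h : SL(2, k) => map ι h * z' * (map ι h)⁻¹ ∈ 𝒳).card := by
        rw [Nat.card_eq_fintype_card, Fintype.card_subtype]
        exact Finset.card_le_card fun h hh => by
          simp only [Finset.mem_filter, Finset.mem_univ, true_and] at hh ⊢
          exact hsub h hh
    _ ≤ 2 * Fintype.card k * 𝒳.card := card_conjPreimage_le ι z' hzns 𝒳
    _ ≤ 2 * Fintype.card k * (4 * Fintype.card k) := Nat.mul_le_mul_left _ h𝒳card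
    _ = 8 * Fintype.card k ^ 2 := by ring

end Summit.MatrixMultiplication.MatrixMultiplication.Theorems.GradedDesignFamily.Negative
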